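import Literature.Topology.FourManifolds.SliceKnotsFoxMilnorHNN
import Literature.Topology.FourManifolds.SliceKnotsFoxMilnorMetabolizerForms
import HarnessLib

/-!
# Fox–Milnor from the Seifert–van Kampen description: rational and abstract metabolizers

Sibling proof file of `Literature/Topology/FourManifolds/SliceKnots.lean` for the named facts
`Literature.Topology.FourManifolds.exists_eq_mul_invert_of_isTopologicallySlice` and
`Literature.Topology.FourManifolds.exists_eq_mul_invert_of_isSmoothlySlice` (Fox–Milnor (1966),
Thm. 2: the Alexander polynomial of a slice knot is `± tᵏ f(t) f(t⁻¹)`). It joins the two existing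
reductions of these facts to their geometric half:

* `SliceKnotsFoxMilnorHNN.lean` (`Knot.exists_eq_mul_invert_of_hnn_presentation`): the knot group is
  given as an HNN extension `HNN(G; A, φ)` over a Seifert surface (Seifert–van Kampen), with a
  `ℤ`-basis `b` of `Gᵃᵇ = H₁(S³ ∖ F)`, generators `aᵢ` of `A = π₁(F)` whose push-off coordinates are
  the columns / rows of the Seifert matrix `V`, and an **integral** metabolizer `U ≤ ℤⁿ` of `V`;
* `SliceKnotsFoxMilnorMetabolizerForms.lean`: the metabolizer in the two shapes in which the
  geometric argument actually delivers it — a **rational** subspace `W ≤ ℚⁿ` of half dimension on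
  which `vᵀ V w` vanishes ("half lives, half dies" is Poincaré–Lefschetz duality with *field*
  coefficients: Kauffman (1987), Ch. VIII, Lemma 8.1 and Thm. 8.2; in the tree
  `Literature.AlgebraicTopology.SingularHomology.two_mul_finrank_range_cohomologyMap_eq`), or an
  isotropic subgroup / subspace of an **abstract** module carrying the Seifert form as a bilinear
  form (Livingston (2005), §2.2 and proof of Thm. 2.6: `L = ker (H₁(F) → H₁(R))`).

## Main statements (all proved; no definition, no named fact, no `sorry`)

* `FoxMilnor.isotropic_map_equivFun_rat`, `FoxMilnor.finrank_map_equivFun_rat` — coordinates of a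
  `ℚ`-basis carry an isotropic subspace of a bilinear form whose matrix is the integer matrix `V` to
  a subspace of `ℚⁿ` of the same dimension on which `vᵀ V w` vanishes;
* `Knot.exists_eq_mul_invert_of_hnn_rat_presentation` — Fox–Milnor for a knot from the HNN data of
  `Knot.exists_eq_mul_invert_of_hnn_presentation` and a rational metabolizer `W ≤ ℚⁿ` of `V`;
* `Knot.exists_eq_mul_invert_of_hnn_ratForm_presentation` — the same with the metabolizer an
  isotropic half-dimensional subspace `L` of a `ℚ`-vector space `H` (`= H₁(F; ℚ)`) with a basis in
  which the bilinear form `β` (the rational Seifert form) has matrix `V`;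
* `Knot.exists_eq_mul_invert_of_hnn_seifertForm_presentation` — the same over `ℤ`: `H` (`= H₁(F; ℤ)`)
  free with basis `bH`, the Seifert form `β : H → H → ℤ`, the push-off coordinates read through `β`,
  and an isotropic subgroup `L ≤ H` of half rank;
* `exists_eq_mul_invert_of_isTopologicallySlice_of_hnn_rat_presentation`,
  `exists_eq_mul_invert_of_isSmoothlySlice_of_hnn_rat_presentation` — the two named facts from the
  geometric half in Seifert–van Kampen form with a RATIONAL metabolizer, stated as an explicit
  hypothesis (NOT a named fact).

With these, the geometric half of either fact consists exactly of: (i) the Seifert–van Kampen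
isomorphism of the knot group with `HNN(π₁(S³ ∖ F); π₁(F), φ)` (meridian ↦ stable letter); (ii) the
linking-number duality `H₁(S³ ∖ F) ≅ Hom(H₁(F), ℤ)` identifying the push-off coordinates with the
Seifert matrix (Rolfsen (1976), §5.C, §8.C); (iii) for a slice disc `D`, a `3`-manifold (or any
compact pair obeying Poincaré–Lefschetz duality over `ℚ`) `R ⊆ B⁴` with `∂R = F ∪ D`, whose kernel
`ker (H₁(F; ℚ) → H₁(R; ℚ))` has dimension `g` and is isotropic for the Seifert form (Kauffman (1987),
Thm. 8.2; Livingston (2005), Thm. 2.6, and §6 for the locally flat case).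

## References

* R. H. Fox, J. W. Milnor, *Singularities of 2-spheres in 4-space and cobordism of knots*, Osaka
  J. Math. 3 (1966), 257–267, Thm. 2. [FoxMilnor1966]
* L. H. Kauffman, *On Knots*, Ann. of Math. Studies 115 (1987), Ch. VIII, Lemma 8.1, Thm. 8.2–8.3.
  [Kauffman1987]
* C. Livingston, *A survey of classical knot concordance*, in: Handbook of Knot Theory (2005), §2.2,
  Thm. 2.6, §3.3, §6. [Livingston2005]
* D. Rolfsen, *Knots and Links* (1976), §5.C, §8.C. [Rolfsen1976]

## Design notes

Theorems only (D-0026). The integral statement consumed is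
`Knot.exists_eq_mul_invert_of_hnn_presentation` (`SliceKnotsFoxMilnorHNN.lean`); the passage from a
rational metabolizer to an integral one (`W ∩ ℤⁿ` is a metabolizer: saturation and
`FoxMilnor.finrank_comap_compLeft_eq_finrank`) is `SliceKnotsFoxMilnorMetabolizerForms.lean`. For the
abstract integral shape the module `H` carries an arbitrary `[Module ℤ H]` instance (the carrier of a
`ModuleCat ℤ` object such as `singularHomology ℤ ℤ S 1` need not use `AddCommGroup.toIntModule`
definitionally); rank hypotheses elaborated with either instance are interchangeable
(`Subsingleton (Module ℤ H)`), which is how `FoxMilnor.finrank_map_equivFun` consumes them.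
-/

open scoped LaurentPolynomial
open Function Set Matrix LaurentPolynomial HNNExtension Multiplicative Module

noncomputable section

namespace Literature.Topology.FourManifolds

namespace FoxMilnor

/-! ## Rational Seifert forms in a basis -/

section RatForm

variable {H : Type*} [AddCommGroup H] [Module ℚ H] {n : ℕ}

/-- If the bilinear form `β` on the `ℚ`-vector space `H` has the integer matrix `V` in the basis
`bH` (`β (bH i) (bH j) = V i j`), then the coordinates of `bH` carry a subspace `L ≤ H` on which `β`
vanishes to a subspace of `ℚⁿ` on which the rational form `vᵀ V w` vanishes. [folklore] -/
theorem isotropic_map_equivFun_rat (bH : Basis (Fin n) ℚ H) (β : H →ₗ[ℚ] H →ₗ[ℚ] ℚ)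
    (V : Matrix (Fin n) (Fin n) ℤ) (hβV : ∀ i j, β (bH i) (bH j) = V i j) (L : Submodule ℚ H)
    (hβ : ∀ x ∈ L, ∀ y ∈ L, β x y = 0) :
    ∀ v ∈ L.map (bH.equivFun : H →ₗ[ℚ] Fin n → ℚ), ∀ w ∈ L.map (bH.equivFun : H →ₗ[ℚ] Fin n → ℚ),
      v ⬝ᵥ (V.map ((↑) : ℤ → ℚ) *ᵥ w) = 0 := by
  have hV : V.map ((↑) : ℤ → ℚ) = LinearMap.toMatrix₂ bH bH β := by
    ext i j
    rw [Matrix.map_apply, LinearMap.toMatrix₂_apply, hβV]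
  rintro _ ⟨x, hx, rfl⟩ _ ⟨y, hy, rfl⟩
  rw [hV, LinearEquiv.coe_coe, Module.Basis.equivFun_apply, Module.Basis.equivFun_apply,
    repr_dotProduct_toMatrix₂_mulVec_repr]
  exact hβ x hx y hy

/-- Coordinates preserve the dimension of a subspace. [folklore] -/
theorem finrank_map_equivFun_rat (bH : Basis (Fin n) ℚ H) (L : Submodule ℚ H) :
    Module.finrank ℚ (L.map (bH.equivFun : H →ₗ[ℚ] Fin n → ℚ)) = Module.finrank ℚ L := by
  rw [LinearEquiv.finrank_map_eq]

end RatForm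

end FoxMilnor

/-! ## The knot-level statements -/

namespace Knot

open FoxMilnor

/-- **Fox–Milnor from a Seifert–van Kampen description of the knot group, rational metabolizer.**
As `Knot.exists_eq_mul_invert_of_hnn_presentation` (an isomorphism `Φ` of the knot group with
`HNN(G; A, φ)`, `e : π₁ᵃᵇ ≃* ℤ` with `e [Φ⁻¹ t] = 1`, a `ℤ`-basis `b` of `Gᵃᵇ` with lifts `gⱼ`,
generators `aᵢ` of `A`, and the integer matrix `V` whose `i`-th column / row are the coordinates of
`āᵢ` / `φ(aᵢ)‾` — the Seifert matrix), but with the metabolizer given as a subspace `W ≤ ℚⁿ` with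
`2 · dim W = n` on which the rational form `vᵀ V w` vanishes: the shape produced by "half lives,
half dies" with field coefficients (Kauffman (1987), Ch. VIII, Lemma 8.1 and Thm. 8.2). Then every
Alexander polynomial of `K` is `u · f · f(t⁻¹)`. Composition of
`AlexanderHNN.exists_presentation_laurent_of_mulEquiv` with
`Knot.exists_eq_mul_invert_of_rat_seifert_presentation`.
[cite: Kauffman1987, Ch. VIII Lemma 8.1, Thm. 8.2–8.3] [cite: FoxMilnor1966, Thm. 2] -/
theorem exists_eq_mul_invert_of_hnn_rat_presentation (K : Knot) (x : K.complement)
    {G : Type*} [Group G] {A B : Subgroup G} {φ : A ≃* B}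
    (Φ : K.group x ≃* HNNExtension G A B φ)
    (e : Abelianization (K.group x) ≃* Multiplicative ℤ)
    (he : e (Abelianization.of (Φ.symm t)) = ofAdd 1)
    {n : ℕ} (b : Module.Basis (Fin n) ℤ (Additive (Abelianization G))) (g : Fin n → G)
    (hg : ∀ j, Additive.ofMul (Abelianization.of (g j)) = b j)
    (a : Fin n → A) (ha : Subgroup.closure (Set.range a) = ⊤) (V : Matrix (Fin n) (Fin n) ℤ)
    (hVp : ∀ i j, b.repr (Additive.ofMul (Abelianization.of (a i : G))) j = V j i)
    (hVm : ∀ i j, b.repr (Additive.ofMul (Abelianization.of (φ (a i) : G))) j = V i j)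
    (W : Submodule ℚ (Fin n → ℚ)) (hW : 2 * Module.finrank ℚ W = n)
    (hVW : ∀ v ∈ W, ∀ w ∈ W, v ⬝ᵥ (V.map ((↑) : ℤ → ℚ) *ᵥ w) = 0)
    {Δ : ℤ[T;T⁻¹]} (hΔ : K.IsAlexanderPolynomial Δ) :
    ∃ (f : ℤ[T;T⁻¹]) (u : ℤ[T;T⁻¹]ˣ), Δ = ↑u * f * LaurentPolynomial.invert f := by
  obtain ⟨π, hπ, hker⟩ := AlexanderHNN.exists_presentation_laurent_of_mulEquiv Φ e he b g hg a ha
    Vᵀ V (fun i j => by rw [Matrix.transpose_apply]; exact hVp i j) hVm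
  refine K.exists_eq_mul_invert_of_rat_seifert_presentation x e π hπ V ?_ W hW hVW hΔ
  rw [hker, Matrix.transpose_map]

/-- **Fox–Milnor from a Seifert–van Kampen description, rational Seifert form.** As
`Knot.exists_eq_mul_invert_of_hnn_rat_presentation`, with the metabolizer given abstractly: `H` a
`ℚ`-vector space (`H₁(F; ℚ)`) with a basis `bH` indexed like the generators `aᵢ`, a bilinear form
`β` on `H` (the rational Seifert form) with matrix `V` in that basis, `β (bH i) (bH j) = V i j`, and a
subspace `L ≤ H` with `2 · dim L = n` on which `β` vanishes (the kernel of `H₁(F; ℚ) → H₁(R; ℚ)`,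
Kauffman (1987), Thm. 8.2; Livingston (2005), Thm. 2.6).
[cite: Kauffman1987, Ch. VIII Thm. 8.2–8.3] [cite: Livingston2005, Thm. 2.6] [cite: FoxMilnor1966, Thm. 2] -/
theorem exists_eq_mul_invert_of_hnn_ratForm_presentation (K : Knot) (x : K.complement)
    {G : Type*} [Group G] {A B : Subgroup G} {φ : A ≃* B}
    (Φ : K.group x ≃* HNNExtension G A B φ)
    (e : Abelianization (K.group x) ≃* Multiplicative ℤ)
    (he : e (Abelianization.of (Φ.symm t)) = ofAdd 1)
    {n : ℕ} (b : Module.Basis (Fin n) ℤ (Additive (Abelianization G))) (g : Fin n → G)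
    (hg : ∀ j, Additive.ofMul (Abelianization.of (g j)) = b j)
    (a : Fin n → A) (ha : Subgroup.closure (Set.range a) = ⊤) (V : Matrix (Fin n) (Fin n) ℤ)
    (hVp : ∀ i j, b.repr (Additive.ofMul (Abelianization.of (a i : G))) j = V j i)
    (hVm : ∀ i j, b.repr (Additive.ofMul (Abelianization.of (φ (a i) : G))) j = V i j)
    {H : Type*} [AddCommGroup H] [Module ℚ H] (bH : Basis (Fin n) ℚ H) (β : H →ₗ[ℚ] H →ₗ[ℚ] ℚ)
    (hβV : ∀ i j, β (bH i) (bH j) = V i j)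
    (L : Submodule ℚ H) (hL : 2 * Module.finrank ℚ L = n) (hβ : ∀ y ∈ L, ∀ z ∈ L, β y z = 0)
    {Δ : ℤ[T;T⁻¹]} (hΔ : K.IsAlexanderPolynomial Δ) :
    ∃ (f : ℤ[T;T⁻¹]) (u : ℤ[T;T⁻¹]ˣ), Δ = ↑u * f * LaurentPolynomial.invert f :=
  K.exists_eq_mul_invert_of_hnn_rat_presentation x Φ e he b g hg a ha V hVp hVm
    (L.map (bH.equivFun : H →ₗ[ℚ] Fin n → ℚ)) (by rw [finrank_map_equivFun_rat]; exact hL)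
    (isotropic_map_equivFun_rat bH β V hβV L hβ) hΔ

/-- **Fox–Milnor from a Seifert–van Kampen description, integral Seifert form.** As
`Knot.exists_eq_mul_invert_of_hnn_presentation`, with the Seifert matrix and the metabolizer given
through the Seifert form itself: `H` a free abelian group (`H₁(F; ℤ)`) with a basis `bH` indexed like
the generators `aᵢ`, a bilinear form `β : H → H → ℤ` (the Seifert form `β(y, z) = lk(y, z⁺)`,
Rolfsen (1976), §8.C; Livingston (2005), §2.2), the push-off coordinates read through `β` — the
coordinates of `āᵢ` in the basis `b` of `Gᵃᵇ` are `(β (bH j) (bH i))ⱼ` and those of `φ(aᵢ)‾` are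
`(β (bH i) (bH j))ⱼ` (linking-number duality `H₁(S³ ∖ F) ≅ Hom(H₁ F, ℤ)`, Rolfsen §5.C) — and a
subgroup `L ≤ H` with `2 · rank L = n` on which `β` vanishes (Livingston, proof of Thm. 2.6: the
kernel of `H₁(F) → H₁(R)`). [cite: Livingston2005, §2.2, Thm. 2.6] [cite: Rolfsen1976, §5.C, §8.C]
[cite: FoxMilnor1966, Thm. 2] -/
theorem exists_eq_mul_invert_of_hnn_seifertForm_presentation (K : Knot) (x : K.complement)
    {G : Type*} [Group G] {A B : Subgroup G} {φ : A ≃* B}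
    (Φ : K.group x ≃* HNNExtension G A B φ)
    (e : Abelianization (K.group x) ≃* Multiplicative ℤ)
    (he : e (Abelianization.of (Φ.symm t)) = ofAdd 1)
    {n : ℕ} (b : Module.Basis (Fin n) ℤ (Additive (Abelianization G))) (g : Fin n → G)
    (hg : ∀ j, Additive.ofMul (Abelianization.of (g j)) = b j)
    (a : Fin n → A) (ha : Subgroup.closure (Set.range a) = ⊤)
    {H : Type*} [AddCommGroup H] [Module ℤ H] (bH : Basis (Fin n) ℤ H) (β : H →ₗ[ℤ] H →ₗ[ℤ] ℤ)
    (hVp : ∀ i j, b.repr (Additive.ofMul (Abelianization.of (a i : G))) j = β (bH j) (bH i))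
    (hVm : ∀ i j, b.repr (Additive.ofMul (Abelianization.of (φ (a i) : G))) j = β (bH i) (bH j))
    (L : Submodule ℤ H) (hL : 2 * Module.finrank ℤ L = n) (hβ : ∀ y ∈ L, ∀ z ∈ L, β y z = 0)
    {Δ : ℤ[T;T⁻¹]} (hΔ : K.IsAlexanderPolynomial Δ) :
    ∃ (f : ℤ[T;T⁻¹]) (u : ℤ[T;T⁻¹]ˣ), Δ = ↑u * f * LaurentPolynomial.invert f := by
  classical
  refine K.exists_eq_mul_invert_of_hnn_presentation x Φ e he b g hg a ha (LinearMap.toMatrix₂ bH bH β)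
    (fun i j => by rw [LinearMap.toMatrix₂_apply]; exact hVp i j)
    (fun i j => by rw [LinearMap.toMatrix₂_apply]; exact hVm i j)
    (L.map (bH.equivFun : H →ₗ[ℤ] Fin n → ℤ)) (by rw [finrank_map_equivFun bH L rfl]; convert hL using 2)
    (isotropic_map_equivFun bH β L hβ) hΔ

end Knot

/-! ## The named facts of `SliceKnots.lean` from the geometric half with a rational metabolizer -/

/-- **Reduction of the topological Fox–Milnor fact to its geometric half, Seifert–van Kampen form
with a rational metabolizer.** If every topologically slice knot admits the HNN data of
`Knot.exists_eq_mul_invert_of_hnn_presentation` (Seifert–van Kampen over a Seifert surface `F`,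
linking-number duality for the push-offs) together with a subspace `W ≤ ℚⁿ` of half dimension on
which the rational Seifert form `vᵀ V w` vanishes (locally flat slice disc ⇒ "half lives, half dies"
with field coefficients: Livingston (2005), Thm. 2.6 and §6; Kauffman (1987), Lemma 8.1, Thm. 8.2),
then `exists_eq_mul_invert_of_isTopologicallySlice` holds. The hypothesis is explicit, NOT a named
fact; everything downstream of it is proved. [cite: FoxMilnor1966, Thm. 2]
[cite: Livingston2005, Thm. 2.6, §6] [cite: Kauffman1987, Ch. VIII Lemma 8.1, Thm. 8.2] -/
theorem exists_eq_mul_invert_of_isTopologicallySlice_of_hnn_rat_presentation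
    (h : ∀ K : Knot, K.IsTopologicallySlice →
      ∃ (x : K.complement) (G : Type) (_ : Group G) (A B : Subgroup G) (φ : A ≃* B)
        (Φ : K.group x ≃* HNNExtension G A B φ) (e : Abelianization (K.group x) ≃* Multiplicative ℤ)
        (n : ℕ) (b : Module.Basis (Fin n) ℤ (Additive (Abelianization G))) (g : Fin n → G)
        (a : Fin n → A) (V : Matrix (Fin n) (Fin n) ℤ) (W : Submodule ℚ (Fin n → ℚ)),
        e (Abelianization.of (Φ.symm t)) = ofAdd 1 ∧
        (∀ j, Additive.ofMul (Abelianization.of (g j)) = b j) ∧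
        Subgroup.closure (Set.range a) = ⊤ ∧
        (∀ i j, b.repr (Additive.ofMul (Abelianization.of (a i : G))) j = V j i) ∧
        (∀ i j, b.repr (Additive.ofMul (Abelianization.of (φ (a i) : G))) j = V i j) ∧
        2 * Module.finrank ℚ W = n ∧
        ∀ v ∈ W, ∀ w ∈ W, v ⬝ᵥ (V.map ((↑) : ℤ → ℚ) *ᵥ w) = 0) :
    exists_eq_mul_invert_of_isTopologicallySlice := by
  intro K hK Δ hΔ
  obtain ⟨x, G, _, A, B, φ, Φ, e, n, b, g, a, V, W, he, hg, ha, hVp, hVm, hW, hVW⟩ := h K hK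
  exact K.exists_eq_mul_invert_of_hnn_rat_presentation x Φ e he b g hg a ha V hVp hVm W hW hVW hΔ

/-- **Reduction of the smooth Fox–Milnor fact to its geometric half, Seifert–van Kampen form with a
rational metabolizer** (same statement for smoothly slice knots; Kauffman (1987), Ch. VIII, Lemma 8.1
and Thm. 8.2 for the metabolizer of a smooth slice disc). [cite: FoxMilnor1966, Thm. 2]
[cite: Kauffman1987, Ch. VIII Lemma 8.1, Thm. 8.2] -/
theorem exists_eq_mul_invert_of_isSmoothlySlice_of_hnn_rat_presentation
    (h : ∀ K : Knot, K.IsSmoothlySlice →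
      ∃ (x : K.complement) (G : Type) (_ : Group G) (A B : Subgroup G) (φ : A ≃* B)
        (Φ : K.group x ≃* HNNExtension G A B φ) (e : Abelianization (K.group x) ≃* Multiplicative ℤ)
        (n : ℕ) (b : Module.Basis (Fin n) ℤ (Additive (Abelianization G))) (g : Fin n → G)
        (a : Fin n → A) (V : Matrix (Fin n) (Fin n) ℤ) (W : Submodule ℚ (Fin n → ℚ)),
        e (Abelianization.of (Φ.symm t)) = ofAdd 1 ∧
        (∀ j, Additive.ofMul (Abelianization.of (g j)) = b j) ∧
        Subgroup.closure (Set.range a) = ⊤ ∧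
        (∀ i j, b.repr (Additive.ofMul (Abelianization.of (a i : G))) j = V j i) ∧
        (∀ i j, b.repr (Additive.ofMul (Abelianization.of (φ (a i) : G))) j = V i j) ∧
        2 * Module.finrank ℚ W = n ∧
        ∀ v ∈ W, ∀ w ∈ W, v ⬝ᵥ (V.map ((↑) : ℤ → ℚ) *ᵥ w) = 0) :
    exists_eq_mul_invert_of_isSmoothlySlice := by
  intro K hK Δ hΔ
  obtain ⟨x, G, _, A, B, φ, Φ, e, n, b, g, a, V, W, he, hg, ha, hVp, hVm, hW, hVW⟩ := h K hK
  exact K.exists_eq_mul_invert_of_hnn_rat_presentation x Φ e he b g hg a ha V hVp hVm W hW hVW hΔ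

end Literature.Topology.FourManifolds
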